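import Summits.ValiantsHypothesis.ValiantsHypothesis.Theorems.PolyaContinuedLaplaceRigiditySingKCoreLine
import Mathlib.LinearAlgebra.Matrix.ToLinearEquiv

/-!
# Top-dimensional components of `Sing(per₄)` with exactly one zero line, part 3: the octic and
# the non-vanishing of coordinates (the «K-core» of stub B-row of line `component_rigidity`)

Helper file for crux `CoverDecancellation` (stmt-ValiantsHypothesis-17819), line `laplace_rigidity`,
rung row R3 at width 4 (`str₂(per₄) ≥ 5`), read against val-idea-10 g3's line «component_rigidity»
(workfile v4, registered stub `stub_rowPrimeRigidity`).  K-core setting as in `…SingKCoreLine`: a prime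
`P ⊇ subpermIdeal F 4 4 3` of height `≤ 8` containing row `i`, rows `j,k,l` and all columns not
contained in `P`, a point `z` with `ker (f ↦ f(z)) = P`, `u = z_j, v = z_k, r = z_l`,
`w_ab = u_a v_b + u_b v_a`.

* `det_symmZeroDiag_four` — the determinant of the symmetric zero-diagonal `4 × 4` matrix
  `[[0,a,b,c],[a,0,d,e],[b,d,0,f],[c,e,f,0]]` is `a²f² + b²e² + c²d² − 2abef − 2acdf − 2bcde`;
* **`octic_eq_zero`** (T6) — at the generic point, `det M(u,v) = X² + Y² + Z² − 2(XY + XZ + YZ) = 0`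
  with `X = w₀₁w₂₃`, `Y = w₀₂w₁₃`, `Z = w₀₃w₁₂` (`M(u,v) · r = 0`, `r ≠ 0`, Mathlib
  `Matrix.exists_mulVec_eq_zero_iff`);
* **`coord_ne_zero`** (T7) — at the generic point NO coordinate of the rows `j, k, l` vanishes
  (`2 ≠ 0`, `3 ≠ 0` in `F`): `u_c = 0` together with the octic is a non-trivial relation
  `v_c² · Q(…) = 0` among the seven other coordinates of `u, v` (non-trivial by the witness
  `u = 𝟙 − e_c`, `v = 𝟙`, value `−12`), so `trdeg_F F[u,v] ≤ 6` and, by the kernel line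
  (`…SingKCoreLine.trdeg_le_trdeg_rows_add_one`), `trdeg_F F[z] ≤ 7 < 8`.  In ideal terms: such a
  `P` contains NO variable outside row `i`.

Part 4 (`…SingKCoreBinomial`) excludes the binomials `u_c v_{c'} − γ u_{c'} v_c`; with the GRADING
half of val-idea-10's LEMMA B this closes stub B-row.  Honest framing: structure lemmas;
`str₂(per₄) ≥ 5`, `StrengthTwoPerFour` (stmt-25160), `CentralLaplaceRigidity`, `CoverDecancellation`,
VP ≠ VNP are OPEN and NOT moved; no summit statement is touched.  val-width-17819-w1 g2, 2026-08-28.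

References: G. Kirkup, Trans. AMS 360 (2008), Prop. 11 / Thm. 14 [Kirkup2005].
-/

set_option linter.dupNamespace false

noncomputable section

namespace Summit.ValiantsHypothesis.ValiantsHypothesis.Theorems.PolyaContinuedLaplaceRigidity.SingCodim

open MvPolynomial Cardinal
open Summit.ValiantsHypothesis.ValiantsHypothesis.Theorems.SymPencilPerFourHessianRankThreeZero (eq_or_of_four)
open Literature.Computability.AlgebraicComplexity
open Literature.Computability.AlgebraicComplexity.BoraleviCarliniMichalekVentura2025

variable {F : Type*} [Field F] {L : Type*} [Field L] [Algebra F L]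

/-! ### The octic `det M(u,v)` -/

/-- **The determinant of a symmetric zero-diagonal `4 × 4` matrix.** [folklore] -/
theorem det_symmZeroDiag_four {R : Type*} [CommRing R] (a b c d e f : R) :
    Matrix.det !![(0 : R), a, b, c; a, 0, d, e; b, d, 0, f; c, e, f, 0] =
      a ^ 2 * f ^ 2 + b ^ 2 * e ^ 2 + c ^ 2 * d ^ 2 - 2 * a * b * e * f - 2 * a * c * d * f -
        2 * b * c * d * e := by
  simp [Matrix.det_succ_row_zero, Fin.sum_univ_succ, Matrix.submatrix_apply, Fin.succAbove,
    Matrix.of_apply, Matrix.cons_val']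
  ring

/-- **T6 — THE OCTIC VANISHES AT THE GENERIC POINT.**  For a prime `P ⊇ subpermIdeal F 4 4 3`, a
point `z` with kernel `P`, and three rows `j, k, l` with row `l` not contained in `P`:
`det M(z_j, z_k) = X² + Y² + Z² − 2XY − 2XZ − 2YZ = 0`, where `X = w₀₁w₂₃`, `Y = w₀₂w₁₃`,
`Z = w₀₃w₁₂` and `w_ab = z_{ja} z_{kb} + z_{jb} z_{ka}` (`M(z_j,z_k) · z_l = 0` with `z_l ≠ 0`).
[cite: Kirkup2005, Prop. 11] -/
theorem octic_eq_zero {P : Ideal (MvPolynomial (Fin 4 × Fin 4) F)}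
    (hle : subpermIdeal F 4 4 3 ≤ P) {j k l : Fin 4} (hjk : j ≠ k) (hjl : j ≠ l) (hkl : k ≠ l)
    (hl : ∃ c, (X (l, c) : MvPolynomial (Fin 4 × Fin 4) F) ∉ P)
    (z : Fin 4 × Fin 4 → L) (hker : RingHom.ker (aeval (R := F) z) = P) :
    (z (j, 0) * z (k, 1) + z (j, 1) * z (k, 0)) ^ 2 * (z (j, 2) * z (k, 3) + z (j, 3) * z (k, 2)) ^ 2 +
      (z (j, 0) * z (k, 2) + z (j, 2) * z (k, 0)) ^ 2 * (z (j, 1) * z (k, 3) + z (j, 3) * z (k, 1)) ^ 2 +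
      (z (j, 0) * z (k, 3) + z (j, 3) * z (k, 0)) ^ 2 * (z (j, 1) * z (k, 2) + z (j, 2) * z (k, 1)) ^ 2 -
      2 * ((z (j, 0) * z (k, 1) + z (j, 1) * z (k, 0)) * (z (j, 2) * z (k, 3) + z (j, 3) * z (k, 2))) *
        ((z (j, 0) * z (k, 2) + z (j, 2) * z (k, 0)) * (z (j, 1) * z (k, 3) + z (j, 3) * z (k, 1))) -
      2 * ((z (j, 0) * z (k, 1) + z (j, 1) * z (k, 0)) * (z (j, 2) * z (k, 3) + z (j, 3) * z (k, 2))) *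
        ((z (j, 0) * z (k, 3) + z (j, 3) * z (k, 0)) * (z (j, 1) * z (k, 2) + z (j, 2) * z (k, 1))) -
      2 * ((z (j, 0) * z (k, 2) + z (j, 2) * z (k, 0)) * (z (j, 1) * z (k, 3) + z (j, 3) * z (k, 1))) *
        ((z (j, 0) * z (k, 3) + z (j, 3) * z (k, 0)) * (z (j, 1) * z (k, 2) + z (j, 2) * z (k, 1))) = 0 := by
  classical
  set w : Fin 4 → Fin 4 → L := fun a b => z (j, a) * z (k, b) + z (j, b) * z (k, a) with hw
  set r : Fin 4 → L := fun c => z (l, c) with hr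
  set M : Matrix (Fin 4) (Fin 4) L :=
    !![(0 : L), w 2 3, w 1 3, w 1 2; w 2 3, 0, w 0 3, w 0 2; w 1 3, w 0 3, 0, w 0 1;
      w 1 2, w 0 2, w 0 1, 0] with hM
  have hT1 : ∀ c₀ c₁ c₂ : Fin 4, c₀ ≠ c₁ → c₀ ≠ c₂ → c₁ ≠ c₂ →
      w c₀ c₁ * r c₂ + w c₀ c₂ * r c₁ + w c₁ c₂ * r c₀ = 0 := fun c₀ c₁ c₂ k₀₁ k₀₂ k₁₂ =>
    subperm_rows_eq_zero hle z hker hjk hjl hkl k₀₁ k₀₂ k₁₂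
  have hMr : M.mulVec r = 0 := by
    ext a
    fin_cases a
    · simp [hM, Matrix.mulVec, dotProduct, Fin.sum_univ_four, Matrix.cons_val']
      linear_combination hT1 1 2 3 (by decide) (by decide) (by decide)
    · simp [hM, Matrix.mulVec, dotProduct, Fin.sum_univ_four, Matrix.cons_val']
      linear_combination hT1 0 2 3 (by decide) (by decide) (by decide)
    · simp [hM, Matrix.mulVec, dotProduct, Fin.sum_univ_four, Matrix.cons_val']
      linear_combination hT1 0 1 3 (by decide) (by decide) (by decide)
    · simp [hM, Matrix.mulVec, dotProduct, Fin.sum_univ_four, Matrix.cons_val']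
      linear_combination hT1 0 1 2 (by decide) (by decide) (by decide)
  have hr0 : r ≠ 0 := by
    obtain ⟨c, hc⟩ := hl
    intro h
    apply hc
    rw [X_mem_iff_eq_zero z hker]
    exact congrFun h c
  have hdet : M.det = 0 := Matrix.exists_mulVec_eq_zero_iff.1 ⟨r, hr0, hMr⟩
  rw [hM, det_symmZeroDiag_four] at hdet
  simp only [hw] at hdet
  linear_combination hdet

/-! ### T7: no coordinate vanishes -/

/-- The complement of one index in `Fin 4` together with `Fin 4` has seven elements. -/
theorem card_compl_singleton_sum_four (c : Fin 4) :
    Fintype.card ({x : Fin 4 // x ≠ c} ⊕ Fin 4) = 7 := by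
  rw [Fintype.card_sum, Fintype.card_subtype_compl, Fintype.card_fin]
  simp

/-- **T7 — NO COORDINATE OF THE THREE ROWS VANISHES at the generic point of a K-core prime.**
Hypotheses as in `trdeg_le_trdeg_rows_add_one` (`2 ≠ 0` in `F`); conclusion `z_{jc} ≠ 0` for the row
`j` (any of the three, by symmetry of the hypotheses; `2 ≠ 0`, `3 ≠ 0` in `F`).  Equivalently such a
`P` contains no variable outside row `i`. [cite: Kirkup2005, Thm. 14] -/
theorem coord_ne_zero (h2 : (2 : F) ≠ 0) (h3 : (3 : F) ≠ 0)
    {P : Ideal (MvPolynomial (Fin 4 × Fin 4) F)} [P.IsPrime]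
    (hle : subpermIdeal F 4 4 3 ≤ P) (h8 : P.height ≤ 8) {i j k l : Fin 4} (hij : i ≠ j) (hik : i ≠ k)
    (hil : i ≠ l) (hjk : j ≠ k) (hjl : j ≠ l) (hkl : k ≠ l)
    (hrow : ∀ c, (X (i, c) : MvPolynomial (Fin 4 × Fin 4) F) ∈ P)
    (hj : ∃ c, (X (j, c) : MvPolynomial (Fin 4 × Fin 4) F) ∉ P)
    (hk : ∃ c, (X (k, c) : MvPolynomial (Fin 4 × Fin 4) F) ∉ P)
    (hl : ∃ c, (X (l, c) : MvPolynomial (Fin 4 × Fin 4) F) ∉ P)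
    (hcol : ∀ c, ∃ ρ, (X (ρ, c) : MvPolynomial (Fin 4 × Fin 4) F) ∉ P)
    (z : Fin 4 × Fin 4 → L) (hker : RingHom.ker (aeval (R := F) z) = P) (c : Fin 4) :
    z (j, c) ≠ 0 := by
  classical
  intro hzc
  have h2L : (2 : L) ≠ 0 := by
    intro h
    apply h2
    apply (algebraMap F L).injective
    rw [map_ofNat, map_zero, h]
  set u : Fin 4 → L := fun x => z (j, x) with hu
  set v : Fin 4 → L := fun x => z (k, x) with hv
  -- the kernel line and the octic
  have hT5 := trdeg_le_trdeg_rows_add_one h2 hle h8 hij hik hil hjk hjl hkl hrow hj hk hl hcol z hker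
  have hT6 := octic_eq_zero hle hjk hjl hkl hl z hker
  have h8z := eight_le_trdeg h8 z hker
  -- the seven remaining coordinates of `u, v`
  set ω : ({x : Fin 4 // x ≠ c} ⊕ Fin 4) → L := fun s => Sum.elim (fun x => u x.1) v s with hω
  -- the relation: the octic with `u_c ↦ 0`
  set U : Fin 4 → MvPolynomial ({x : Fin 4 // x ≠ c} ⊕ Fin 4) F := fun x =>
    if hx : x = c then 0 else X (Sum.inl ⟨x, hx⟩) with hU
  set V : Fin 4 → MvPolynomial ({x : Fin 4 // x ≠ c} ⊕ Fin 4) F := fun x => X (Sum.inr x) with hV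
  set W : Fin 4 → Fin 4 → MvPolynomial ({x : Fin 4 // x ≠ c} ⊕ Fin 4) F := fun a b =>
    U a * V b + U b * V a with hW
  set H : MvPolynomial ({x : Fin 4 // x ≠ c} ⊕ Fin 4) F :=
    (W 0 1) ^ 2 * (W 2 3) ^ 2 + (W 0 2) ^ 2 * (W 1 3) ^ 2 + (W 0 3) ^ 2 * (W 1 2) ^ 2 -
      2 * (W 0 1 * W 2 3) * (W 0 2 * W 1 3) - 2 * (W 0 1 * W 2 3) * (W 0 3 * W 1 2) -
      2 * (W 0 2 * W 1 3) * (W 0 3 * W 1 2) with hH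
  -- evaluating `U, V` at `ω` recovers `u, v`
  have hUω : ∀ x, aeval ω (U x) = u x := by
    intro x
    by_cases hx : x = c
    · subst hx; simp [hU, hu, hzc]
    · simp [hU, hx, hω]
  have hVω : ∀ x, aeval ω (V x) = v x := by
    intro x; simp [hV, hω]
  have hWω : ∀ a b, aeval ω (W a b) = u a * v b + u b * v a := by
    intro a b; simp only [hW, map_add, map_mul, hUω, hVω]
  have hHω : aeval ω H = 0 := by
    simp only [hH, map_add, map_sub, map_mul, map_pow, hWω, map_ofNat]
    simpa [hu, hv] using hT6
  -- `H ≠ 0`: evaluate at `u = 𝟙 − e_c`, `v = 𝟙` (value `−12 = 2²·(−3)`)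
  have key : ∀ c₀ : Fin 4,
      (((if (0 : Fin 4) = c₀ then (0 : F) else 1) * 1 + (if (1 : Fin 4) = c₀ then (0 : F) else 1) * 1) ^ 2 *
          ((if (2 : Fin 4) = c₀ then (0 : F) else 1) * 1 + (if (3 : Fin 4) = c₀ then (0 : F) else 1) * 1) ^ 2 +
        ((if (0 : Fin 4) = c₀ then (0 : F) else 1) * 1 + (if (2 : Fin 4) = c₀ then (0 : F) else 1) * 1) ^ 2 *
          ((if (1 : Fin 4) = c₀ then (0 : F) else 1) * 1 + (if (3 : Fin 4) = c₀ then (0 : F) else 1) * 1) ^ 2 +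
        ((if (0 : Fin 4) = c₀ then (0 : F) else 1) * 1 + (if (3 : Fin 4) = c₀ then (0 : F) else 1) * 1) ^ 2 *
          ((if (1 : Fin 4) = c₀ then (0 : F) else 1) * 1 + (if (2 : Fin 4) = c₀ then (0 : F) else 1) * 1) ^ 2 -
        2 * (((if (0 : Fin 4) = c₀ then (0 : F) else 1) * 1 + (if (1 : Fin 4) = c₀ then (0 : F) else 1) * 1) *
          ((if (2 : Fin 4) = c₀ then (0 : F) else 1) * 1 + (if (3 : Fin 4) = c₀ then (0 : F) else 1) * 1)) *
          (((if (0 : Fin 4) = c₀ then (0 : F) else 1) * 1 + (if (2 : Fin 4) = c₀ then (0 : F) else 1) * 1) *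
          ((if (1 : Fin 4) = c₀ then (0 : F) else 1) * 1 + (if (3 : Fin 4) = c₀ then (0 : F) else 1) * 1)) -
        2 * (((if (0 : Fin 4) = c₀ then (0 : F) else 1) * 1 + (if (1 : Fin 4) = c₀ then (0 : F) else 1) * 1) *
          ((if (2 : Fin 4) = c₀ then (0 : F) else 1) * 1 + (if (3 : Fin 4) = c₀ then (0 : F) else 1) * 1)) *
          (((if (0 : Fin 4) = c₀ then (0 : F) else 1) * 1 + (if (3 : Fin 4) = c₀ then (0 : F) else 1) * 1) *
          ((if (1 : Fin 4) = c₀ then (0 : F) else 1) * 1 + (if (2 : Fin 4) = c₀ then (0 : F) else 1) * 1)) -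
        2 * (((if (0 : Fin 4) = c₀ then (0 : F) else 1) * 1 + (if (2 : Fin 4) = c₀ then (0 : F) else 1) * 1) *
          ((if (1 : Fin 4) = c₀ then (0 : F) else 1) * 1 + (if (3 : Fin 4) = c₀ then (0 : F) else 1) * 1)) *
          (((if (0 : Fin 4) = c₀ then (0 : F) else 1) * 1 + (if (3 : Fin 4) = c₀ then (0 : F) else 1) * 1) *
          ((if (1 : Fin 4) = c₀ then (0 : F) else 1) * 1 + (if (2 : Fin 4) = c₀ then (0 : F) else 1) * 1))) =
        -12 := by
    intro c₀
    fin_cases c₀ <;> simp <;> norm_num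
  set pt : ({x : Fin 4 // x ≠ c} ⊕ Fin 4) → F := fun _ => 1 with hpt
  have hUpt : ∀ x, eval pt (U x) = if x = c then 0 else 1 := by
    intro x
    by_cases hx : x = c
    · subst hx; simp [hU]
    · simp [hU, hx, hpt]
  have hVpt : ∀ x, eval pt (V x) = 1 := by
    intro x; simp [hV, hpt]
  have hWpt : ∀ a b, eval pt (W a b) = (if a = c then 0 else 1) * 1 + (if b = c then 0 else 1) * 1 := by
    intro a b; simp only [hW, map_add, map_mul, hUpt, hVpt]
  have hH0 : H ≠ 0 := by
    intro hH0
    have hev : eval pt H = 0 := by rw [hH0, map_zero]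
    simp only [hH, map_add, map_sub, map_mul, map_pow, hWpt, map_ofNat] at hev
    rw [key c] at hev
    have h12 : (12 : F) ≠ 0 := by
      rw [show (12 : F) = 2 * 2 * 3 by norm_num]
      exact mul_ne_zero (mul_ne_zero h2 h2) h3
    exact h12 (by linear_combination -hev)
  -- the count: `trdeg F[u,v] ≤ trdeg F[ω] ≤ 6`, so `trdeg F[z] ≤ 7 < 8`
  have hω6 : Algebra.trdeg F (Algebra.adjoin F (Set.range ω)) ≤ (6 : ℕ) := by
    have h := trdeg_adjoin_range_le_of_aeval_eq_zero_fintype (F := F) ω hH0 hHω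
    rwa [card_compl_singleton_sum_four] at h
  have hS6 : Algebra.trdeg F (Algebra.adjoin F
      (Set.range (fun x => z (j, x)) ∪ Set.range (fun x => z (k, x)))) ≤ (6 : ℕ) := by
    refine le_trans (trdeg_adjoin_le_trdeg_of_forall_alg fun y hy => ?_) hω6
    rcases hy with ⟨x, rfl⟩ | ⟨x, rfl⟩
    · by_cases hx : x = c
      · subst hx; exact alg_of_eq_zero _ hzc
      · exact alg_of_mem ⟨Sum.inl ⟨x, hx⟩, by simp [hω, hu]⟩
    · exact alg_of_mem ⟨Sum.inr x, by simp [hω, hv]⟩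
  have h7 : Algebra.trdeg F (Algebra.adjoin F (Set.range z)) ≤ (6 : ℕ) + 1 :=
    hT5.trans (add_le_add hS6 le_rfl)
  have : (8 : Cardinal) ≤ (6 : ℕ) + 1 := h8z.trans h7
  norm_num at this

end Summit.ValiantsHypothesis.ValiantsHypothesis.Theorems.PolyaContinuedLaplaceRigidity.SingCodim

end
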